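import Literature.AlgebraicGeometry.Morphisms.RigidityLemmaStein
import Literature.AlgebraicGeometry.AbelianSchemes.AbelianSchemeOverSerreLemma
import Literature.AlgebraicGeometry.AbelianSchemes.AbelianSchemeSteinOfNoetherian
import HarnessLib

/-!
# Rigidity, rigidity of homomorphisms and Serre's lemma for abelian schemes over a locally Noetherian connected base
# WITHOUT reducedness — [MumfordFogartyKirwan1994, Ch. 6 §1 Prop. 6.1 / Cor. 6.2; Ch. 7 §3 «lemma of Serre»]

[MumfordFogartyKirwan1994, Ch. 6 §1, Proposition 6.1 p. 115 / Corollary 6.2 p. 116] hold over ANY connected locally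
Noetherian base `S` (Mumford's standing hypothesis «all pre-schemes … locally noetherian», Ch. 6 intro p. 115), in
particular over ARTINIAN bases — the case the deformation theory / the `classify` clause of the fine moduli functor
([MumfordFogartyKirwan1994] Def. 7.2–7.3, test schemes «any locally noetherian scheme `S`») needs.  The tree's
★ `AbelianSchemeOverRigidity` / ★ `AbelianSchemeOverSerreLemma` prove them for a REDUCED total space (or a reduced base);
this file removes the reducedness, using the printed road: the STEIN property `Γ(W, 𝒪_S) ⥲ Γ(p⁻¹W, 𝒪_A)` of an
abelian scheme over a locally Noetherian base (★ `AbelianSchemeOver.app_bijective_of_isLocallyNoetherian`,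
[GortzWedhorn2023] Cor. 24.63) fed into the Stein form of the rigidity lemma (★ `Morphisms.rigidity_of_stein`).

* `rigidity_of_isLocallyNoetherian` — Prop. 6.1 for `A/S`, `S` locally Noetherian preconnected, `Y/S` separated: an
  `S`-morphism `A → Y` contracting ONE fibre is `toUnit ≫ η ≫ f`;
* `eq_section_mul_of_pullback_fst_comp_eq_of_isLocallyNoetherian` (Cor. 6.2) and the RIGIDITY OF HOMOMORPHISMS
  `hom_eq_of_pullback_fst_comp_eq_of_isLocallyNoetherian` / `hom_eq_of_pullback_map_eq_…` / `hom_eq_of_fiberι_comp_eq_…`: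
  two homomorphisms to a separated `S`-group scheme agreeing on one (geometric) fibre are equal;
* `eq_id_of_pow_eq_one_of_forall_fibrePoints_of_isLocallyNoetherian` — SERRE'S LEMMA over a locally Noetherian
  connected base (finite-order endomorphism trivial on the `n`-torsion of one geometric fibre, `n ≥ 3` ⇒ identity): the
  field case is ★ `eq_id_of_pow_eq_one_of_forall_fibrePoints_of_isReduced_base` applied to the FIBRE `A ×_S Spec K`
  over the (reduced) base `Spec K`, and rigidity of homomorphisms over `S` concludes;
  `LevelStructure.eq_id_of_pow_eq_one_of_forall_σ_comp_of_isLocallyNoetherian` — level structures rigidify.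

Theorems only; no named fact, no `sorry`, no instance, no notation.  Cell hodgecm-mathlib, F-DAG (input (F)
`lan2013_siegelFineModuliScheme`) leaf F-1 (a)/(d) (`B-provers/B-p03/g16/F-DAG-PRICE.B-p03g16.md` §3 F-1, §5 first hand 1);
consumers: F-6 (II)/(V), F-7 (freeness of the `GL`-action on `H_{g,δ,N}`), F-10 (free `Γ`-action), F-12 (`classify` over
non-reduced `T`).  HC_CM is proved only modulo the printed citations until rung 0 closes; this file discharges none of them.

## References
* [MumfordFogartyKirwan1994] D. Mumford, J. Fogarty, F. Kirwan, *Geometric Invariant Theory*, 3rd ed., Springer 1994,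
  Ch. 6 §1 Prop. 6.1 (pp. 115–116), Cor. 6.2 (p. 116); Ch. 7 §3 remark after Thm. 7.9 (p. 139, «lemma of Serre»).
* [MumfordAV1970] D. Mumford, *Abelian Varieties*, §4 (rigidity lemma, p. 43).
* [Milne1986AbelianVarieties] J. S. Milne, *Abelian Varieties*, in Cornell–Silverman (1986), Prop. 17.5 (b) (p. 139).
* [GortzWedhorn2023] U. Görtz, T. Wedhorn, *Algebraic Geometry II* (2023), Cor. 24.63 (p. 404).
-/

noncomputable section

universe u

open CategoryTheory CategoryTheory.Limits AlgebraicGeometry MonObj MonoidalCategory CartesianMonoidalCategory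

namespace Literature.AlgebraicGeometry.AbelianSchemes

namespace AbelianSchemeOver

variable {S : Scheme.{u}} (A : AbelianSchemeOver S)

/-! ### Prop. 6.1 — rigidity, no reducedness -/

/-- **RIGIDITY LEMMA FOR ABELIAN SCHEMES over a locally Noetherian preconnected base** ([MumfordFogartyKirwan1994]
Prop. 6.1), NO reducedness: `Y/S` separated, `f : A → Y` an `S`-morphism mapping the fibre over ONE point `s₀` to a
single point ⇒ `f = toUnit ≫ η ≫ f`.  Proof: ★ `Morphisms.rigidity_of_stein` with the Stein property ★
`app_bijective_of_isLocallyNoetherian`. [cite: MumfordFogartyKirwan1994, Ch. 6 §1 Proposition 6.1 (Rigidity lemma) (pp. 115–116)] -/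
theorem rigidity_of_isLocallyNoetherian [IsLocallyNoetherian S] [PreconnectedSpace S] {Y : Over S}
    [IsSeparated Y.hom] (f : A.X ⟶ Y) {s₀ : S} {y₀ : Y.left}
    (h₀ : ∀ x : A.X.left, A.X.hom.base x = s₀ → f.left.base x = y₀) :
    f = toUnit A.X ≫ η[A.X] ≫ f := by
  haveI := A.universallyOpen_hom
  haveI := A.universallyClosed_hom
  ext : 1
  rw [Over.comp_left, Over.comp_left, Over.toUnit_left]
  exact Literature.AlgebraicGeometry.Morphisms.rigidity_of_stein f.left (Over.w f) (η[A.X]).left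
    A.unit_left_comp_hom (fun W => A.app_bijective_of_isLocallyNoetherian W) h₀

/-! ### Cor. 6.2 — rigidity of homomorphisms, no reducedness -/

/-- **[MumfordFogartyKirwan1994] Cor. 6.2 over a locally Noetherian preconnected base**, at a field-valued point: two
`S`-morphisms `f, g : A → G` to a separated `S`-group scheme agreeing on the geometric fibre over `t : Spec K → S` satisfy
`f = (toUnit ≫ η_A ≫ f·g⁻¹) · g`. [cite: MumfordFogartyKirwan1994, Ch. 6 §1 Corollary 6.2 (p. 116)] -/
theorem eq_section_mul_of_pullback_fst_comp_eq_of_isLocallyNoetherian [IsLocallyNoetherian S] [PreconnectedSpace S]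
    {G : Over S} [GrpObj G] [IsSeparated G.hom] (f g : A.X ⟶ G) {K : Type u} [Field K] (t : Spec (.of K) ⟶ S)
    (h : pullback.fst A.X.hom t ≫ f.left = pullback.fst A.X.hom t ≫ g.left) :
    f = (toUnit A.X ≫ η[A.X] ≫ (f * g⁻¹)) * g := by
  -- the geometric fibre as an `S`-scheme over `A`
  let j : Over.mk (pullback.fst A.X.hom t ≫ A.X.hom) ⟶ A.X := Over.homMk (pullback.fst A.X.hom t) rfl
  have hj : j ≫ f = j ≫ g := by
    ext : 1
    exact h
  have hq : j ≫ (f * g⁻¹) = toUnit _ ≫ η[G] := by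
    rw [MonObj.comp_mul, GrpObj.comp_inv, hj, mul_inv_cancel, Hom.one_def]
  -- `f · g⁻¹` contracts the fibre over the image point `s₀` of `t` to the unit point `η_G(s₀)`
  let s₀ : S := t.base (IsLocalRing.closedPoint K)
  have h₀ : ∀ x : A.X.left, A.X.hom.base x = s₀ → (f * g⁻¹).left.base x = (η[G]).left.base s₀ := by
    intro x hx
    obtain ⟨x', rfl⟩ : x ∈ Set.range (pullback.fst A.X.hom t).base := by
      rw [Scheme.Pullback.range_fst]
      exact ⟨IsLocalRing.closedPoint K, hx.symm⟩
    have hx' : A.X.hom.base ((pullback.fst A.X.hom t).base x') = s₀ := hx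
    have := congrArg (fun φ : Over.mk (pullback.fst A.X.hom t ≫ A.X.hom) ⟶ G => φ.left.base x') hq
    simp only [Over.comp_left, Scheme.Hom.comp_base, TopCat.comp_app, Over.toUnit_left] at this
    change (f * g⁻¹).left.base ((pullback.fst A.X.hom t).base x') =
      (η[G]).left.base ((pullback.fst A.X.hom t ≫ A.X.hom).base x') at this
    rw [this, Scheme.Hom.comp_apply, hx']
  conv_lhs => rw [← inv_mul_cancel_right f g, ← div_eq_mul_inv]
  rw [div_eq_mul_inv, ← A.rigidity_of_isLocallyNoetherian (f * g⁻¹) h₀]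

/-- **Cor. 6.2 at a scheme-theoretic fibre** `A_{s₀} ↪ A`, locally Noetherian preconnected base, no reducedness.
[cite: MumfordFogartyKirwan1994, Ch. 6 §1 Corollary 6.2 (p. 116)] -/
theorem eq_section_mul_of_fiberι_comp_eq_of_isLocallyNoetherian [IsLocallyNoetherian S] [PreconnectedSpace S]
    {G : Over S} [GrpObj G] [IsSeparated G.hom] (f g : A.X ⟶ G) (s₀ : S)
    (h : A.X.hom.fiberι s₀ ≫ f.left = A.X.hom.fiberι s₀ ≫ g.left) :
    f = (toUnit A.X ≫ η[A.X] ≫ (f * g⁻¹)) * g :=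
  A.eq_section_mul_of_pullback_fst_comp_eq_of_isLocallyNoetherian f g (K := S.residueField s₀)
    (S.fromSpecResidueField s₀) h

/-- **RIGIDITY OF HOMOMORPHISMS over a locally Noetherian preconnected base** (from Cor. 6.2), no reducedness: two
homomorphisms `f, g : A → G` to a separated `S`-group scheme which agree on ONE geometric fibre (`t : Spec K → S`) are
equal. [cite: MumfordFogartyKirwan1994, Ch. 6 §1 Corollary 6.2 (p. 116)] -/
theorem hom_eq_of_pullback_fst_comp_eq_of_isLocallyNoetherian [IsLocallyNoetherian S] [PreconnectedSpace S]
    {G : Over S} [GrpObj G] [IsSeparated G.hom] (f g : A.X ⟶ G) [IsMonHom f] [IsMonHom g] {K : Type u} [Field K]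
    (t : Spec (.of K) ⟶ S) (h : pullback.fst A.X.hom t ≫ f.left = pullback.fst A.X.hom t ≫ g.left) : f = g := by
  have key := A.eq_section_mul_of_pullback_fst_comp_eq_of_isLocallyNoetherian f g t h
  have hη : η[A.X] ≫ (f * g⁻¹) = 1 := by
    rw [MonObj.comp_mul, GrpObj.comp_inv, IsMonHom.one_hom, IsMonHom.one_hom, mul_inv_cancel]
  rw [hη, MonObj.comp_one, _root_.one_mul] at key
  exact key

/-- **Base-change form**, locally Noetherian preconnected base, no reducedness: homomorphisms whose base changes to some
field-valued point coincide are equal. [cite: MumfordFogartyKirwan1994, Ch. 6 §1 Corollary 6.2 (p. 116)] -/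
theorem hom_eq_of_pullback_map_eq_of_isLocallyNoetherian [IsLocallyNoetherian S] [PreconnectedSpace S]
    {G : Over S} [GrpObj G] [IsSeparated G.hom] (f g : A.X ⟶ G) [IsMonHom f] [IsMonHom g] {K : Type u} [Field K]
    (t : Spec (.of K) ⟶ S) (h : (Over.pullback t).map f = (Over.pullback t).map g) : f = g := by
  refine A.hom_eq_of_pullback_fst_comp_eq_of_isLocallyNoetherian f g t ?_
  have hf : ((Over.pullback t).map f).left ≫ pullback.fst G.hom t = pullback.fst A.X.hom t ≫ f.left := by
    simp only [Over.pullback_map_left]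
    erw [pullback.lift_fst]
  have hg : ((Over.pullback t).map g).left ≫ pullback.fst G.hom t = pullback.fst A.X.hom t ≫ g.left := by
    simp only [Over.pullback_map_left]
    erw [pullback.lift_fst]
  rw [← hf, ← hg, h]

/-- **Rigidity of homomorphisms at a scheme-theoretic fibre**, locally Noetherian preconnected base, no reducedness.
[cite: MumfordFogartyKirwan1994, Ch. 6 §1 Corollary 6.2 (p. 116)] -/
theorem hom_eq_of_fiberι_comp_eq_of_isLocallyNoetherian [IsLocallyNoetherian S] [PreconnectedSpace S]
    {G : Over S} [GrpObj G] [IsSeparated G.hom] (f g : A.X ⟶ G) [IsMonHom f] [IsMonHom g] (s₀ : S)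
    (h : A.X.hom.fiberι s₀ ≫ f.left = A.X.hom.fiberι s₀ ≫ g.left) : f = g :=
  A.hom_eq_of_pullback_fst_comp_eq_of_isLocallyNoetherian f g (K := S.residueField s₀) (S.fromSpecResidueField s₀) h

/-! ### Serre's lemma over a locally Noetherian connected base, no reducedness -/

/-- **SERRE'S LEMMA OVER A LOCALLY NOETHERIAN CONNECTED BASE** ([MumfordFogartyKirwan1994] Ch. 7 §3 with Ch. 6 §1
Cor. 6.2; [Milne1986AbelianVarieties] Prop. 17.5 (b)), NO reducedness: `σ` an `S`-endomorphism of the group scheme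
`A` of finite order (`σᵐ = 1`, `m > 0`), `t : Spec K → S` a field-valued point, `n ≥ 3` invertible in `K`; if `σ` fixes
every `n`-torsion `K̄`-point of the fibre over `t`, then `σ = 1`.  Proof: the base change `σ ×_S Spec K` of `σ` to the
fibre `A ×_S Spec K` — an abelian scheme over the REDUCED base `Spec K` — satisfies the hypotheses of ★
`eq_id_of_pow_eq_one_of_forall_fibrePoints_of_isReduced_base` (its torsion points over `Spec K̄ → Spec K` correspond to
those of `A` over `Spec K̄ → S`, ★ `fibrePointsBaseChangeEquiv`), hence is the identity; rigidity of homomorphisms over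
the connected base `S` (`hom_eq_of_pullback_map_eq_of_isLocallyNoetherian`) gives `σ = 1`.
[cite: MumfordFogartyKirwan1994, Ch. 7 §3, remark after Theorem 7.9 (p. 139) («lemma of Serre»); Ch. 6 §1 Corollary 6.2 (p. 116)]
[cite: Milne1986AbelianVarieties, Prop. 17.5 (b) (p. 139)] -/
theorem eq_id_of_pow_eq_one_of_forall_fibrePoints_of_isLocallyNoetherian [IsLocallyNoetherian S]
    [PreconnectedSpace S] (σ : A.X ⟶ A.X) [IsMonHom σ] {m : ℕ} (hm : 0 < m) (hσ : End.of σ ^ m = 1)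
    {K : Type u} [Field K] (t : Spec (.of K) ⟶ S) {n : ℕ} (hn : 3 ≤ n) (hnK : (n : K) ≠ 0)
    (h : ∀ P : A.FibrePoints (Spec.map (CommRingCat.ofHom (algebraMap K (AlgebraicClosure K))) ≫ t),
      P ^ n = 1 → P ≫ σ = P) :
    σ = 𝟙 A.X := by
  -- `σ_t = σ ×_S Spec K`, an endomorphism of the fibre `A_t = A ×_S Spec K` over the REDUCED base `Spec K`,
  -- has finite order
  have hσt : End.of ((Over.pullback t).map σ) ^ m = 1 := by
    have hmap := map_pow ((Over.pullback t).mapEnd A.X) (End.of σ) m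
    rw [hσ, map_one] at hmap
    exact hmap.symm
  -- `σ_t` fixes the `n`-torsion `K̄`-points of the fibre of `A_t` over `𝟙 (Spec K)`
  have hfix : ∀ P : (A.baseChange t).FibrePoints
      (Spec.map (CommRingCat.ofHom (algebraMap K (AlgebraicClosure K))) ≫ 𝟙 (Spec (.of K))), P ^ n = 1 →
      P ≫ (Over.pullback t).map σ = P := by
    intro P hP
    -- the corresponding point of `A` over `(Spec K̄ → Spec K ≫ 𝟙) ≫ t`, moved to `Spec K̄ → Spec K ≫ t` along `eqToHom`
    let e := A.fibrePointsBaseChangeEquiv t (Spec.map (CommRingCat.ofHom (algebraMap K (AlgebraicClosure K))) ≫ 𝟙 (Spec (.of K)))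
    let Q₀ : A.FibrePoints ((Spec.map (CommRingCat.ofHom (algebraMap K (AlgebraicClosure K))) ≫ 𝟙 (Spec (.of K))) ≫ t) := e.symm P
    have hst : Over.mk (Spec.map (CommRingCat.ofHom (algebraMap K (AlgebraicClosure K))) ≫ t) =
        Over.mk ((Spec.map (CommRingCat.ofHom (algebraMap K (AlgebraicClosure K))) ≫ 𝟙 (Spec (.of K))) ≫ t) := by
      rw [Category.comp_id]
    have hQ₀n : Q₀ ^ n = 1 := by
      rw [← map_pow]
      exact (congrArg e.symm hP).trans (map_one e.symm)
    have hQn : (eqToHom hst ≫ Q₀) ^ n = 1 := by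
      rw [← MonObj.comp_pow, hQ₀n, MonObj.comp_one]
    have hQ : (eqToHom hst ≫ Q₀) ≫ σ = eqToHom hst ≫ Q₀ := h _ hQn
    -- cancel `eqToHom`: `Q₀ ≫ σ = Q₀`
    have hQ₀ : Q₀ ≫ σ = Q₀ := by
      rw [← cancel_epi (eqToHom hst), ← Category.assoc]
      exact hQ
    -- transport through `e`: `e (Q₀ ≫ σ) = e Q₀ ≫ σ_t`
    have he : e (Q₀ ≫ σ) = e Q₀ ≫ (Over.pullback t).map σ := by
      rw [fibrePointsBaseChangeEquiv_apply, fibrePointsBaseChangeEquiv_apply]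
      exact (congrArg ((Over.mapPullbackAdj t).unit.app
        (Over.mk (Spec.map (CommRingCat.ofHom (algebraMap K (AlgebraicClosure K))) ≫ 𝟙 (Spec (.of K)))) ≫ ·) ((Over.pullback t).map_comp Q₀ σ)).trans
        (Category.assoc _ _ _).symm
    rw [hQ₀] at he
    have heQ : e Q₀ = P := e.apply_symm_apply _
    rw [heQ] at he
    exact he.symm
  -- Serre's lemma over the reduced locally Noetherian connected base `Spec K`
  haveI : PreconnectedSpace ↥(Spec (CommRingCat.of K)) :=
    ⟨(PreirreducibleSpace.isPreirreducible_univ (X := ↥(Spec (CommRingCat.of K)))).isPreconnected⟩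
  haveI : IsMonHom (M := (A.baseChange t).X) (N := (A.baseChange t).X) ((Over.pullback t).map σ) :=
    Functor.map.instIsMonHom (F := Over.pullback t) A.X A.X σ
  have hσt1 : (Over.pullback t).map σ = 𝟙 (A.baseChange t).X :=
    (A.baseChange t).eq_id_of_pow_eq_one_of_forall_fibrePoints_of_isReduced_base ((Over.pullback t).map σ) hm hσt
      (𝟙 (Spec (.of K))) hn hnK hfix
  -- rigidity of homomorphisms over the connected base `S`
  haveI := A.isSeparated_hom
  refine A.hom_eq_of_pullback_map_eq_of_isLocallyNoetherian σ (𝟙 A.X) t ?_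
  rw [hσt1, (Over.pullback t).map_id]
  rfl

variable {A} in
/-- **LEVEL STRUCTURES RIGIDIFY over a locally Noetherian connected base**, no reducedness ([MumfordFogartyKirwan1994]
Ch. 7 §3, the «lemma of Serre» making `Γ_n` act freely on `𝒜_{g,d,n}`, `n ≥ 3`; [Milne1986AbelianVarieties] Prop. 17.5 (b)):
an `S`-endomorphism `u` of finite order of the group scheme `A` fixing the `2g` basis sections of a level-`n` structure
`φ`, `n ≥ 3` invertible in the residue field of some field-valued point `t`, is the identity.
[cite: MumfordFogartyKirwan1994, Ch. 7 §3, remark after Theorem 7.9 (p. 139) («lemma of Serre»); Ch. 7 §1 Definition 7.1 (p. 129)]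
[cite: Milne1986AbelianVarieties, Prop. 17.5 (b) (p. 139)] -/
theorem LevelStructure.eq_id_of_pow_eq_one_of_forall_σ_comp_of_isLocallyNoetherian [IsLocallyNoetherian S]
    [PreconnectedSpace S] {g n : ℕ} (φ : A.LevelStructure g n) (u : A.X ⟶ A.X) [IsMonHom u] {m : ℕ} (hm : 0 < m)
    (hu : End.of u ^ m = 1) {K : Type u} [Field K] (t : Spec (.of K) ⟶ S) (hn : 3 ≤ n) (hnK : (n : K) ≠ 0)
    (hfix : ∀ i, φ.σ i ≫ u = φ.σ i) : u = 𝟙 A.X := by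
  refine A.eq_id_of_pow_eq_one_of_forall_fibrePoints_of_isLocallyNoetherian u hm hu t hn hnK fun P hP => ?_
  obtain ⟨a, ha⟩ := φ.basis_surjective (Spec.map (CommRingCat.ofHom (algebraMap K (AlgebraicClosure K))) ≫ t) P hP
  rw [← ha]
  change (CartesianMonoidalCategory.toUnit _ ≫ A.sectionPow φ.σ a) ≫ u =
    CartesianMonoidalCategory.toUnit _ ≫ A.sectionPow φ.σ a
  rw [Category.assoc, A.sectionPow_comp_of_isMonHom u φ.σ a]
  congr 2
  funext i
  exact hfix i

end AbelianSchemeOver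

end Literature.AlgebraicGeometry.AbelianSchemes

end
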